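import Literature.Computability.AlgebraicComplexity.MS21DiagonalTensorDecoupling
import HarnessLib

/-!
# Medini–Shpilka 2021, Thm 45 in every characteristic — II: the decoupled endgame, `d = 2`, and
# the discharge `MS2021_thm_45_holds`

Theorem-only file (cell `val-lit`, seat x6 g3). Part I (`MS21DiagonalTensorDecoupling.lean`)
reduced the equal-degree, equal-span case of Thm 45 for `d ≥ 3` to: either a WITNESS (then Lemma
6.2 with `k = 2` on `f₁`, every field) or the two families agree block by block,
`span{ℓ_{1,a,·}} = span{ℓ_{2,β(a),·}}`. This file finishes:

* THE DECOUPLED ENDGAME (`bind₁_sub_ne_zero_of_decoupled`, `d ≥ 3`, every field, 3 blocks): pick a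
  row `a₀` whose difference `g_{a₀} = ∏_j ℓ_{1,a₀,j} - ∏_j ℓ_{2,β(a₀),j}` is nonzero. (E0) If every
  `ℓ_{2,β(a₀),j}` is proportional to some `ℓ_{1,a₀,σ(j)}` then `g_{a₀} = (1 - ∏c) ∏_j ℓ_{1,a₀,j}` and
  one derivative along the dual vector of `ℓ_{1,a₀,0}` (it kills every other row of both families)
  leaves a nonzero product of linear forms. (E1) Otherwise some `λ = ℓ_{2,β(a₀),j₀} = ∑_j μ_j ℓ_{1,a₀,j}`
  has `|supp μ| ≥ 2`: RESTRICT to `ker λ` (Lemma 3.10: `x ↦ x - (λ(x)/λ_i) e_i`), which kills the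
  second product of row `a₀` and leaves the first family independent except for the single relation
  `∑ μ_j ℓ'_{a₀,j} = 0`; then ONE derivative along the dual vector of `ℓ'_{a₀,j₂}` in the independent
  family `{ℓ'_w}_{w ≠ (a₀,j*)}` (`j*, j₃ ∈ supp μ`, `j₂ ∉ {j*, j₃}` — this is where `d ≥ 3` is
  used) produces `∏_{j ∉ {j₂,j*}} ℓ'_{a₀,j} · (ℓ'_{a₀,j*} + τ ℓ'_{a₀,j₂})`, a nonzero product of
  linear forms, hit by any `1`-independent map.
* `d = 2` (`bind₁_sub_ne_zero_of_degree_two`, every field, 2 blocks): `f` is a nonzero quadratic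
  form in the `ℓ_1`; either some `∂f/∂v` is a nonzero LINEAR form (one peel), or all first partials
  vanish — then `char K = 2`, `f = ∑_i φ_i x_i²` is "diagonal" (Frobenius) and the Def-19
  substitution of one block at a coordinate `i` with `φ_i ≠ 0` gives `φ_i z² ≠ 0`.
* `MS2021_thm_45_holds : MS2021_thm_45` — the fact AS TYPED (all fields, uniform `6`-independent
  maps as in the tree's `MS2021.IsUniform`/`IsIndependent`), assembling Step 1 / `d ≤ 1` / the
  span case (this seat's `MS21DiagonalTensorOrbitsHittingProofs.lean`), `d = 2`, the witness branch
  and the decoupled endgame.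

CHARACTERISTIC: the printed sub-case "some `a_{i,j} ≥ 2`" (arXiv p0036:L38-L42) is NOT used; see
the seat note `HOME/np/x6g3-MS21-Thm45-allchar-REPAIR.md` (PRINT-ERRATA candidate: proof gap in
characteristic `p ≤ d`, statement stands). UNIFORMITY (registry B34): used only in Step 1, for the
block SUM, exactly as typed.

No definitions, no facts (D-0026). HONEST FRAMING: a 2021 published PIT theorem, formalised with a
repaired proof; `VP ≠ VNP` is NOT proved and nothing here bears on it beyond row X6-MS21 bookkeeping.

## References
* [MediniShpilka2021] D. Medini, A. Shpilka, CCC 2021 (LIPIcs 200:19) Thm 45 (p.19:14); arXiv:2102.05632,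
  statement p0009:L9-L12, proof §6.2 p0036:L1-L52, Lemmas 3.8–3.10 p0017:L61–p0018:L40.
-/

noncomputable section

open MvPolynomial Matrix

namespace Literature.Computability.AlgebraicComplexity

namespace MS2021

/-! ### Linear forms: derivatives, products, shifts -/

section LinForms

variable {K : Type*} [Field K] {n : ℕ}

/-- `T_{s,d}(Ax)` on pair indices is the explicit sum of products of the linear forms "rows of `A`".
[cite: MediniShpilka2021, Def 40 (arXiv p0008:L51-L55)] -/
theorem affSubst_zero_rename_sum_prod_X {s d : ℕ} (h : s * d ≤ n) (A : Matrix (Fin n) (Fin n) K) :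
    affSubst h A 0 (rename finProdFinEquiv
      (∑ a : Fin s, ∏ j : Fin d, X (a, j) : MvPolynomial (Fin s × Fin d) K)) =
      ∑ a : Fin s, ∏ j : Fin d, ∑ k : Fin n, C (A (Fin.castLE h (finProdFinEquiv (a, j))) k) * X k := by
  unfold affSubst
  simp only [map_sum, map_prod, rename_X, aeval_X, Pi.zero_apply, C_0, add_zero]

/-- `∂/∂x_k` of a linear form is its `k`-th coefficient. [folklore] -/
private theorem pderiv_linform (r : Fin n → K) (k : Fin n) :
    pderiv k (∑ k', C (r k') * X k' : MvPolynomial (Fin n) K) = C (r k) := by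
  simp only [map_sum, pderiv_C_mul, pderiv_X, Pi.single_apply, mul_ite, mul_one, mul_zero,
    Finset.sum_ite_eq', Finset.mem_univ, if_true]

/-- The directional derivative of a linear form is the constant `r · u`. [folklore] -/
private theorem dirDeriv_linform (u r : Fin n → K) :
    (∑ k, C (u k) * pderiv k (∑ k', C (r k') * X k' : MvPolynomial (Fin n) K)) = C (r ⬝ᵥ u) := by
  simp_rw [pderiv_linform, ← map_mul, ← map_sum]
  congr 1
  simp only [dotProduct]
  exact Finset.sum_congr rfl fun k _ => mul_comm _ _

/-- Directional derivatives commute with constants. [folklore] -/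
private theorem dirDeriv_C_mul (u : Fin n → K) (e : K) (P : MvPolynomial (Fin n) K) :
    (∑ k, C (u k) * pderiv k (C e * P)) = C e * ∑ k, C (u k) * pderiv k P := by
  rw [Finset.mul_sum]
  exact Finset.sum_congr rfl fun k _ => by rw [pderiv_C_mul]; ring

/-- **Leibniz rule for a product of linear forms**: `∂_u ∏_{j∈S} ℓ_j = ∑_{j∈S} ℓ_j(u) ∏_{j'≠j} ℓ_{j'}`
("`∂(∏_j ℓ_{1,1,j})/∂v`", p0036:L21). [cite: MediniShpilka2021, proof of Thm 45 (arXiv p0036:L21) and Lemma 6.2 (p0035:L40-L44)] -/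
theorem dirDeriv_prod_linform {ι : Type*} [DecidableEq ι] (S : Finset ι) (r : ι → Fin n → K)
    (u : Fin n → K) :
    (∑ k, C (u k) * pderiv k (∏ j ∈ S, ∑ k', C (r j k') * X k' : MvPolynomial (Fin n) K)) =
      ∑ j ∈ S, C (r j ⬝ᵥ u) * ∏ j' ∈ S.erase j, ∑ k', C (r j' k') * X k' := by
  induction S using Finset.induction_on with
  | empty => simp
  | insert i S hi ih =>
    rw [Finset.prod_insert hi, Finset.sum_insert hi, Finset.erase_insert hi]
    have hsplit : (∑ k, C (u k) * pderiv k ((∑ k', C (r i k') * X k' : MvPolynomial (Fin n) K) *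
        ∏ j ∈ S, ∑ k', C (r j k') * X k')) =
        (∑ k', C (r i k') * X k' : MvPolynomial (Fin n) K) *
            (∑ k, C (u k) * pderiv k (∏ j ∈ S, ∑ k', C (r j k') * X k' : MvPolynomial (Fin n) K)) +
          (∏ j ∈ S, ∑ k', C (r j k') * X k' : MvPolynomial (Fin n) K) *
            ∑ k, C (u k) * pderiv k (∑ k', C (r i k') * X k' : MvPolynomial (Fin n) K) := by
      rw [Finset.mul_sum, Finset.mul_sum, ← Finset.sum_add_distrib]
      refine Finset.sum_congr rfl fun k _ => ?_
      rw [Derivation.leibniz, smul_eq_mul, smul_eq_mul]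
      ring
    rw [hsplit, ih, dirDeriv_linform, add_comm, Finset.mul_sum]
    congr 1
    · ring
    · refine Finset.sum_congr rfl fun j hj => ?_
      rw [Finset.erase_insert_of_ne (fun h : i = j => hi (h ▸ hj)),
        Finset.prod_insert (fun h => hi (Finset.mem_of_mem_erase h))]
      ring

/-- The shift `x ↦ x + L(x) e_i` (Lemma 3.10) maps a linear form `r` to the linear form
`r + r_i · c` (`L = ∑ c_k x_k`). [cite: MediniShpilka2021, Lemma 3.10 (arXiv p0018:L17-L40)] -/
theorem shift_linform (i : Fin n) (c r : Fin n → K) :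
    bind₁ (fun j : Fin n => X j + if j = i then (∑ k, C (c k) * X k : MvPolynomial (Fin n) K) else 0)
      (∑ k, C (r k) * X k : MvPolynomial (Fin n) K) = ∑ k, C (r k + r i * c k) * X k := by
  rw [map_sum]
  simp only [map_mul, bind₁_C_right, bind₁_X_right, mul_add, Finset.sum_add_distrib, mul_ite,
    mul_zero, Finset.sum_ite_eq', Finset.mem_univ, if_true, map_add, add_mul]
  congr 1
  rw [Finset.mul_sum]
  exact Finset.sum_congr rfl fun k _ => by rw [mul_assoc]

/-- A linear form scaled: `∑ C (c r_k) x_k = C c · ∑ C r_k x_k`. [folklore] -/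
private theorem linform_smul (c : K) (r : Fin n → K) :
    (∑ k, C ((c • r) k) * X k : MvPolynomial (Fin n) K) = C c * ∑ k, C (r k) * X k := by
  rw [Finset.mul_sum]
  exact Finset.sum_congr rfl fun k _ => by rw [Pi.smul_apply, smul_eq_mul, map_mul, mul_assoc]

/-- A linear form with a nonzero coefficient is hit by every `k`-independent map, `k ≥ 1`.
[cite: MediniShpilka2021, Obs 3.3 / Def 19 (arXiv p0006:L64-L67)] -/
private theorem bind₁_linform_ne_zero {k t : ℕ} {G : Fin n → MvPolynomial (Fin k × (Fin t ⊕ Unit)) K}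
    (hG : IsIndependent k G) (hk : 1 ≤ k) {r : Fin n → K} (hr : r ≠ 0) :
    bind₁ G (∑ k', C (r k') * X k') ≠ 0 := by
  obtain ⟨k₀, hk₀⟩ : ∃ k₀, r k₀ ≠ 0 := by
    by_contra h
    push Not at h
    exact hr (funext h)
  have := hG.bind₁_affine_ne_zero hk r 0 ⟨k₀, hk₀⟩
  rwa [C_0, add_zero] at this

end LinForms

/-! ### Dot products against a span, dual vectors of an independent family -/

section Duals

variable {K : Type*} [Field K] {n : ℕ}

/-- A vector orthogonal to generators is orthogonal to their span. [folklore] -/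
private theorem dotProduct_eq_zero_of_mem_span {ι : Type*} [Fintype ι] (v : ι → Fin n → K)
    (u : Fin n → K) (hv : ∀ i, v i ⬝ᵥ u = 0) {x : Fin n → K}
    (hx : x ∈ Submodule.span K (Set.range v)) : x ⬝ᵥ u = 0 := by
  obtain ⟨c, rfl⟩ := (Submodule.mem_span_range_iff_exists_fun K).1 hx
  rw [sum_dotProduct]
  refine Finset.sum_eq_zero fun i _ => ?_
  rw [smul_dotProduct, hv i, smul_zero]

end Duals

/-! ### Peeling with a shift (Lemma 3.10) -/

section PeelShift

variable {K : Type*} [Field K] {n c : ℕ}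

/-- **Lemma 3.10, as used here**: to show that a `(k+1)`-independent map hits `f` it suffices that
every `k`-independent map hits the shifted polynomial `f(x + L(x) e_i)` (restriction to a hyperplane
when `L = -λ(x)/λ_i`). [cite: MediniShpilka2021, Lemma 3.10 (CCC p.19:10; arXiv p0018:L17-L40)] -/
theorem bind₁_ne_zero_of_forall_shift {k : ℕ}
    {G : Fin n → MvPolynomial (Fin (k + 1) × (Fin c ⊕ Unit)) K} (hG : IsIndependent (k + 1) G)
    (f : MvPolynomial (Fin n) K) (i : Fin n) (L : MvPolynomial (Fin n) K)
    (h : ∀ G' : Fin n → MvPolynomial (Fin k × (Fin c ⊕ Unit)) K, IsIndependent k G' →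
      bind₁ G' (bind₁ (fun j => X j + if j = i then L else 0) f) ≠ 0) :
    bind₁ G f ≠ 0 := by
  obtain ⟨G₁, G', hG₁, hG', hGeq⟩ := isIndependent_succ_iff.1 hG
  have hfun : G = fun j => rename (Prod.mk 0) (G₁ j) + rename (Prod.map Fin.succ id) (G' j) :=
    funext hGeq
  rw [hfun]
  exact bind₁_peel_ne_zero_of_shift hG₁ G' f i L (h G' hG')

end PeelShift

/-! ### The decoupled endgame (`d ≥ 3`, every field) -/

section Endgame

variable {K : Type*} [Field K] {n c s d : ℕ}

/-- Sums over `Fin s × Fin d` supported in one row. [folklore] -/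
private theorem sum_row_support {M : Type*} [AddCommMonoid M] [Module K M] (a₀ : Fin s)
    (g : Fin d → K) (v : Fin s × Fin d → M) :
    (∑ w : Fin s × Fin d, (if w.1 = a₀ then g w.2 else 0) • v w) = ∑ j : Fin d, g j • v (a₀, j) := by
  rw [Fintype.sum_prod_type, Finset.sum_eq_single a₀]
  · exact Finset.sum_congr rfl fun j _ => by rw [if_pos rfl]
  · intro a _ ha
    exact Finset.sum_eq_zero fun j _ => by rw [if_neg ha, zero_smul]
  · intro h
    exact absurd (Finset.mem_univ a₀) h

/-- **Thm 45, `d ≥ 3`, the decoupled case** (every field): two linearly independent families of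
explicit linear forms `ℓ_{1,(a,j)}`, `ℓ_{2,(a,j)}` with `ℓ_{2,(a,j)} ∈ span{ℓ_{1,(a,·)}}` for every
`a` ("from this point on we assume … `span = span`", here row by row), and
`f = ∑_a ∏_j ℓ_{1,(a,j)} - ∑_a ∏_j ℓ_{2,(a,j)} ≠ 0`. Then every `3`-independent map hits `f`:
restriction to `ker ℓ_{2,(a₀,j₀)}` (Lemma 3.10), one dual derivative (Lemmas 3.8/3.9), and a nonzero
product of linear forms (Obs 3.3) — see the module docstring.
[cite: MediniShpilka2021, proof of Thm 45 (arXiv p0036:L26-L50), repaired (seat note x6g3-MS21-Thm45-allchar-REPAIR.md §3)] -/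
theorem bind₁_sub_ne_zero_of_decoupled (hd : 3 ≤ d) {k : ℕ}
    (R₁ R₂ : Fin s × Fin d → Fin n → K) (hR₁ : LinearIndependent K R₁)
    (hR₂ : LinearIndependent K R₂)
    (hspan : ∀ (a : Fin s) (j : Fin d),
      R₂ (a, j) ∈ Submodule.span K (Set.range fun j' : Fin d => R₁ (a, j')))
    (hne : (∑ a : Fin s, ∏ j : Fin d, ∑ k', C (R₁ (a, j) k') * X k' : MvPolynomial (Fin n) K) -
      ∑ a : Fin s, ∏ j : Fin d, ∑ k', C (R₂ (a, j) k') * X k' ≠ 0)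
    {G : Fin n → MvPolynomial (Fin (k + 3) × (Fin c ⊕ Unit)) K} (hG : IsIndependent (k + 3) G) :
    bind₁ G ((∑ a : Fin s, ∏ j : Fin d, ∑ k', C (R₁ (a, j) k') * X k' : MvPolynomial (Fin n) K) -
      ∑ a : Fin s, ∏ j : Fin d, ∑ k', C (R₂ (a, j) k') * X k') ≠ 0 := by
  classical
  have hd0 : 0 < d := by omega
  -- a row whose difference is nonzero
  obtain ⟨a₀, ha₀⟩ : ∃ a₀ : Fin s, (∏ j : Fin d, ∑ k', C (R₁ (a₀, j) k') * X k' :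
      MvPolynomial (Fin n) K) - ∏ j : Fin d, ∑ k', C (R₂ (a₀, j) k') * X k' ≠ 0 := by
    by_contra h
    push Not at h
    apply hne
    rw [← Finset.sum_sub_distrib]
    exact Finset.sum_eq_zero fun a _ => h a
  -- every form of a row `a ≠ a₀` (of either family) is a combination of the `ℓ_{1,(a,·)}`
  have hrow₂ : ∀ (a : Fin s) (j : Fin d), ∃ κ : Fin d → K, R₂ (a, j) = ∑ j', κ j' • R₁ (a, j') :=
    fun a j => by
      obtain ⟨κ, hκ⟩ := (Submodule.mem_span_range_iff_exists_fun K).1 (hspan a j)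
      exact ⟨κ, hκ.symm⟩
  -- nonzero forms
  have hR₁ne : ∀ w, R₁ w ≠ 0 := fun w => hR₁.ne_zero w
  have hR₂ne : ∀ w, R₂ w ≠ 0 := fun w => hR₂.ne_zero w
  by_cases hE0 : ∀ j : Fin d, ∃ (j' : Fin d) (e : K), R₂ (a₀, j) = e • R₁ (a₀, j')
  · /- (E0): every `ℓ_{2,(a₀,j)}` is proportional to some `ℓ_{1,(a₀,σ j)}`; then
    `∏_j ℓ_{2,(a₀,j)} = (∏ e_j) ∏_j ℓ_{1,(a₀,j)}` and one dual derivative finishes. -/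
    choose σ e hσ using hE0
    have he : ∀ j, e j ≠ 0 := by
      intro j h0
      exact hR₂ne (a₀, j) (by rw [hσ j, h0, zero_smul])
    have hσinj : Function.Injective σ := by
      intro j j' hjj
      by_contra hne'
      -- `e j' • ℓ_{2,j} - e j • ℓ_{2,j'} = 0` contradicts the independence of the second family
      have hdep := Fintype.linearIndependent_iff.1 hR₂
        (Pi.single (a₀, j) (e j') - Pi.single (a₀, j') (e j)) (by
          have h2 : ∀ w : Fin s × Fin d, (Pi.single (a₀, j) (e j') - Pi.single (a₀, j') (e j) :
              Fin s × Fin d → K) w • R₂ w =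
              (if w = (a₀, j) then e j' • R₂ (a₀, j) else 0) -
                (if w = (a₀, j') then e j • R₂ (a₀, j') else 0) := by
            intro w
            rw [Pi.sub_apply, sub_smul, Pi.single_apply, Pi.single_apply]
            congr 1 <;> split_ifs with h <;> simp [h]
          simp_rw [h2, Finset.sum_sub_distrib, Finset.sum_ite_eq', Finset.mem_univ, if_true]
          rw [hσ j, hσ j', hjj, smul_smul, smul_smul, mul_comm, sub_self])
        (a₀, j)
      rw [Pi.sub_apply, Pi.single_eq_same, Pi.single_apply,
        if_neg (fun h => hne' (Prod.mk.inj h).2), sub_zero] at hdep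
      exact he j' hdep
    have hσbij : Function.Bijective σ := ⟨hσinj, Finite.surjective_of_injective hσinj⟩
    -- the product identity
    have hprod : (∏ j : Fin d, ∑ k', C (R₂ (a₀, j) k') * X k' : MvPolynomial (Fin n) K) =
        C (∏ j, e j) * ∏ j : Fin d, ∑ k', C (R₁ (a₀, j) k') * X k' := by
      have h1 : (∏ j : Fin d, ∑ k', C (R₂ (a₀, j) k') * X k' : MvPolynomial (Fin n) K) =
          ∏ j : Fin d, (C (e j) * ∑ k', C (R₁ (a₀, σ j) k') * X k') :=
        Finset.prod_congr rfl fun j _ => by rw [hσ j, linform_smul]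
      rw [h1, Finset.prod_mul_distrib, map_prod]
      congr 1
      exact (Equiv.ofBijective σ hσbij).prod_comp fun j => (∑ k', C (R₁ (a₀, j) k') * X k' :
        MvPolynomial (Fin n) K)
    have hcoef : (1 : K) - ∏ j, e j ≠ 0 := by
      intro h0
      apply ha₀
      have h1 : ∏ j, e j = 1 := (sub_eq_zero.1 h0).symm
      rw [hprod, h1, C_1, one_mul, sub_self]
    -- the dual vector of `ℓ_{1,(a₀,0)}` in the first family
    obtain ⟨u, hu1, hu0⟩ : ∃ u : Fin n → K, R₁ (a₀, ⟨0, hd0⟩) ⬝ᵥ u = 1 ∧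
        ∀ w, w ≠ (a₀, ⟨0, hd0⟩) → R₁ w ⬝ᵥ u = 0 := by
      obtain ⟨u, hu1, hu0⟩ := exists_dotProduct_eq_one_of_notMem_span
        (fun w : ↥({w | w ≠ (a₀, (⟨0, hd0⟩ : Fin d))} : Set (Fin s × Fin d)) => R₁ w)
        (R₁ (a₀, ⟨0, hd0⟩)) (by
          rw [← Set.image_eq_range]
          exact hR₁.notMem_span_image (s := {w | w ≠ (a₀, (⟨0, hd0⟩ : Fin d))})
            (x := (a₀, ⟨0, hd0⟩)) (fun h => h rfl))
      exact ⟨u, hu1, fun w hw => hu0 ⟨w, hw⟩⟩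
    have hu₂ : ∀ w, w.1 ≠ a₀ → R₂ w ⬝ᵥ u = 0 := by
      rintro ⟨a, j⟩ ha
      obtain ⟨κ, hκ⟩ := hrow₂ a j
      rw [hκ, sum_dotProduct]
      refine Finset.sum_eq_zero fun j' _ => ?_
      rw [smul_dotProduct, hu0 (a, j') (fun h => ha (Prod.mk.inj h).1), smul_zero]
    refine bind₁_ne_zero_of_forall_dirDeriv hG _ u fun G' hG' => ?_
    -- the derivative: `(1 - ∏ e) ∏_{j ≠ 0} ℓ_{1,(a₀,j)}`
    have hD₁ : ∀ a : Fin s, (∑ k', C (u k') * pderiv k'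
        (∏ j : Fin d, ∑ k'', C (R₁ (a, j) k'') * X k'' : MvPolynomial (Fin n) K)) =
        if a = a₀ then ∏ j ∈ Finset.univ.erase (⟨0, hd0⟩ : Fin d), ∑ k', C (R₁ (a₀, j) k') * X k'
        else 0 := by
      intro a
      rw [dirDeriv_prod_linform]
      split_ifs with ha
      · subst ha
        rw [Finset.sum_eq_single (⟨0, hd0⟩ : Fin d), hu1, C_1, one_mul]
        · intro j _ hj
          rw [hu0 (a, j) (fun h => hj (Prod.mk.inj h).2), C_0, zero_mul]
        · intro h
          exact absurd (Finset.mem_univ _) h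
      · exact Finset.sum_eq_zero fun j _ => by
          rw [hu0 (a, j) (fun h => ha (Prod.mk.inj h).1), C_0, zero_mul]
    have hD₂ : ∀ a : Fin s, (∑ k', C (u k') * pderiv k'
        (∏ j : Fin d, ∑ k'', C (R₂ (a, j) k'') * X k'' : MvPolynomial (Fin n) K)) =
        if a = a₀ then C (∏ j, e j) *
          ∏ j ∈ Finset.univ.erase (⟨0, hd0⟩ : Fin d), ∑ k', C (R₁ (a₀, j) k') * X k'
        else 0 := by
      intro a
      split_ifs with ha
      · subst ha
        rw [hprod, dirDeriv_C_mul, hD₁, if_pos rfl]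
      · rw [dirDeriv_prod_linform]
        exact Finset.sum_eq_zero fun j _ => by rw [hu₂ (a, j) ha, C_0, zero_mul]
    have hlin : ∀ (p q : MvPolynomial (Fin n) K),
        (∑ k', C (u k') * pderiv k' (p - q)) = (∑ k', C (u k') * pderiv k' p) -
          ∑ k', C (u k') * pderiv k' q := by
      intro p q
      simp only [map_sub, mul_sub, Finset.sum_sub_distrib]
    have hsum : ∀ (P : Fin s → MvPolynomial (Fin n) K),
        (∑ k', C (u k') * pderiv k' (∑ a, P a)) = ∑ a, ∑ k', C (u k') * pderiv k' (P a) := by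
      intro P
      simp_rw [map_sum, Finset.mul_sum]
      exact Finset.sum_comm
    rw [hlin, hsum, hsum]
    simp_rw [hD₁, hD₂, Finset.sum_ite_eq', Finset.mem_univ, if_true]
    have hfac : (∏ j ∈ Finset.univ.erase (⟨0, hd0⟩ : Fin d), ∑ k', C (R₁ (a₀, j) k') * X k' :
        MvPolynomial (Fin n) K) - C (∏ j, e j) *
          ∏ j ∈ Finset.univ.erase (⟨0, hd0⟩ : Fin d), ∑ k', C (R₁ (a₀, j) k') * X k' =
        C (1 - ∏ j, e j) *
          ∏ j ∈ Finset.univ.erase (⟨0, hd0⟩ : Fin d), ∑ k', C (R₁ (a₀, j) k') * X k' := by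
      rw [map_sub, C_1, sub_mul, one_mul]
    rw [hfac, map_mul, bind₁_C_right, map_prod]
    refine mul_ne_zero (C_ne_zero.2 hcoef) (Finset.prod_ne_zero_iff.2 fun j _ => ?_)
    exact bind₁_linform_ne_zero hG' (by omega) (hR₁ne (a₀, j))
  · /- (E1): some `λ = ℓ_{2,(a₀,j₀)} = ∑_j μ_j ℓ_{1,(a₀,j)}` has two nonzero `μ`'s: restrict to
    `ker λ`, differentiate along the dual vector of `ℓ'_{1,(a₀,j₂)}`, get a product of forms. -/
    push Not at hE0
    obtain ⟨j₀, hj₀⟩ := hE0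
    obtain ⟨μ, hμ⟩ : ∃ μ : Fin d → K, R₂ (a₀, j₀) = ∑ j, μ j • R₁ (a₀, j) := hrow₂ a₀ j₀
    -- two distinct indices in the support of `μ`, and a third index
    obtain ⟨js, j₃, hjs, hj₃, hj3s⟩ : ∃ js j₃ : Fin d, μ js ≠ 0 ∧ μ j₃ ≠ 0 ∧ js ≠ j₃ := by
      by_contra hno
      push Not at hno
      -- then `μ` has at most one nonzero entry, so `λ` is proportional to one `ℓ_{1,(a₀,j)}`
      have hμ0 : ∃ js, ∀ j, j ≠ js → μ j = 0 := by
        by_cases hall : ∀ j, μ j = 0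
        · exact ⟨⟨0, hd0⟩, fun j _ => hall j⟩
        · push Not at hall
          obtain ⟨js, hjs⟩ := hall
          exact ⟨js, fun j hj => by
            by_contra hμj
            exact hj (hno js j hjs hμj).symm⟩
      obtain ⟨js, hjs⟩ := hμ0
      apply hj₀ js (μ js)
      rw [hμ, Finset.sum_eq_single js]
      · intro j _ hj
        rw [hjs j hj, zero_smul]
      · intro h
        exact absurd (Finset.mem_univ js) h
    obtain ⟨j₂, hj₂s, hj₂₃⟩ : ∃ j₂ : Fin d, j₂ ≠ js ∧ j₂ ≠ j₃ := by
      by_contra hno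
      push Not at hno
      have hsub : (Finset.univ : Finset (Fin d)) ⊆ {js, j₃} := by
        intro j _
        rw [Finset.mem_insert, Finset.mem_singleton]
        by_cases h1 : j = js
        · exact Or.inl h1
        · exact Or.inr (hno j h1)
      have h1 := Finset.card_le_card hsub
      rw [Finset.card_univ, Fintype.card_fin] at h1
      have h2 := Finset.card_insert_le js ({j₃} : Finset (Fin d))
      rw [Finset.card_singleton] at h2
      omega
    -- `λ ≠ 0`: a coordinate `i` with `λ_i ≠ 0`
    obtain ⟨i, hi⟩ : ∃ i, R₂ (a₀, j₀) i ≠ 0 := by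
      by_contra h
      push Not at h
      exact hR₂ne (a₀, j₀) (funext h)
    -- the shift `L = -λ(x)/λ_i` and the restricted rows `r' = r - (r_i/λ_i) λ`
    refine bind₁_ne_zero_of_forall_shift hG _ i
      (∑ k', C (-R₂ (a₀, j₀) k' / R₂ (a₀, j₀) i) * X k') fun G' hG' => ?_
    have hshift : ∀ (R : Fin s × Fin d → Fin n → K),
        bind₁ (fun j : Fin n => X j + if j = i then
          (∑ k', C (-R₂ (a₀, j₀) k' / R₂ (a₀, j₀) i) * X k' : MvPolynomial (Fin n) K) else 0)
          (∑ a : Fin s, ∏ j : Fin d, ∑ k', C (R (a, j) k') * X k') =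
        ∑ a : Fin s, ∏ j : Fin d, ∑ k', C (R (a, j) k' + R (a, j) i *
          (-R₂ (a₀, j₀) k' / R₂ (a₀, j₀) i)) * X k' := by
      intro R
      simp_rw [map_sum, map_prod, shift_linform]
    rw [map_sub, hshift, hshift]
    -- notation-free abbreviations for the restricted families
    obtain ⟨R₁', hR₁'⟩ : ∃ R₁' : Fin s × Fin d → Fin n → K,
        R₁' = fun w k' => R₁ w k' + R₁ w i * (-R₂ (a₀, j₀) k' / R₂ (a₀, j₀) i) := ⟨_, rfl⟩
    obtain ⟨R₂', hR₂'⟩ : ∃ R₂' : Fin s × Fin d → Fin n → K,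
        R₂' = fun w k' => R₂ w k' + R₂ w i * (-R₂ (a₀, j₀) k' / R₂ (a₀, j₀) i) := ⟨_, rfl⟩
    have hF₁ : (∑ a : Fin s, ∏ j : Fin d, ∑ k', C (R₁ (a, j) k' + R₁ (a, j) i *
        (-R₂ (a₀, j₀) k' / R₂ (a₀, j₀) i)) * X k' : MvPolynomial (Fin n) K) =
        ∑ a : Fin s, ∏ j : Fin d, ∑ k', C (R₁' (a, j) k') * X k' := by rw [hR₁']
    have hF₂ : (∑ a : Fin s, ∏ j : Fin d, ∑ k', C (R₂ (a, j) k' + R₂ (a, j) i *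
        (-R₂ (a₀, j₀) k' / R₂ (a₀, j₀) i)) * X k' : MvPolynomial (Fin n) K) =
        ∑ a : Fin s, ∏ j : Fin d, ∑ k', C (R₂' (a, j) k') * X k' := by rw [hR₂']
    rw [hF₁, hF₂]
    -- the restriction map `ρ` is linear and kills `λ`
    have hρlin : ∀ (κ : Fin d → K) (a : Fin s) (R : Fin s × Fin d → Fin n → K),
        (fun k' => (∑ j', κ j' • R (a, j')) k' + (∑ j', κ j' • R (a, j')) i *
          (-R₂ (a₀, j₀) k' / R₂ (a₀, j₀) i)) =
        ∑ j', κ j' • fun k' => R (a, j') k' + R (a, j') i * (-R₂ (a₀, j₀) k' / R₂ (a₀, j₀) i) := by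
      intro κ a R
      funext k'
      simp only [Finset.sum_apply, Pi.smul_apply, smul_eq_mul, Finset.sum_mul, ← Finset.sum_add_distrib]
      exact Finset.sum_congr rfl fun j' _ => by ring
    have hlam : R₂' (a₀, j₀) = 0 := by
      rw [hR₂']
      funext k'
      simp only [Pi.zero_apply]
      field_simp
      ring
    have hrel : (∑ j, μ j • R₁' (a₀, j)) = 0 := by
      have e := hρlin μ a₀ R₁
      rw [← hμ] at e
      have e2 : R₂' (a₀, j₀) = ∑ j, μ j • R₁' (a₀, j) := by
        rw [hR₂', hR₁']
        exact e
      rw [← e2, hlam]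
    -- rows `a ≠ a₀` of the second restricted family lie in the span of the first
    have hrow₂' : ∀ (a : Fin s) (j : Fin d), ∃ κ : Fin d → K, R₂' (a, j) = ∑ j', κ j' • R₁' (a, j') := by
      intro a j
      obtain ⟨κ, hκ⟩ := hrow₂ a j
      refine ⟨κ, ?_⟩
      rw [hR₂', hR₁']
      have := hρlin κ a R₁
      rw [← hκ] at this
      exact this
    -- independence of the restricted first family off the index `(a₀, js)`
    have hind : ∀ g : Fin s × Fin d → K, g (a₀, js) = 0 → (∑ w, g w • R₁' w) = 0 → ∀ w, g w = 0 := by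
      intro g hg0 hsum
      obtain ⟨θ, hθdef⟩ : ∃ θ : K, θ = (∑ w, g w * R₁ w i) / R₂ (a₀, j₀) i := ⟨_, rfl⟩
      -- `∑ g_w ℓ_{1,w} = θ λ = θ ∑ μ_j ℓ_{1,(a₀,j)}`
      have hθ : (∑ w, g w • R₁ w) = θ • R₂ (a₀, j₀) := by
        funext k'
        have h0 := congr_fun hsum k'
        rw [hR₁'] at h0
        simp only [Finset.sum_apply, Pi.smul_apply, smul_eq_mul, Pi.zero_apply] at h0 ⊢
        have hexp : (∑ w, g w * (R₁ w k' + R₁ w i * (-R₂ (a₀, j₀) k' / R₂ (a₀, j₀) i))) =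
            (∑ w, g w * R₁ w k') + (∑ w, g w * R₁ w i) * (-R₂ (a₀, j₀) k' / R₂ (a₀, j₀) i) := by
          rw [Finset.sum_mul, ← Finset.sum_add_distrib]
          exact Finset.sum_congr rfl fun w _ => by ring
        rw [hexp] at h0
        have e1 : (∑ w, g w * R₁ w k') =
            (∑ w, g w * R₁ w i) * (R₂ (a₀, j₀) k' / R₂ (a₀, j₀) i) := by
          linear_combination h0
        rw [e1, hθdef]
        ring
      rw [hμ, Finset.smul_sum] at hθ
      simp_rw [smul_smul] at hθ
      -- compare coefficients in the independent first family
      have hcomb : (∑ w : Fin s × Fin d, (g w - if w.1 = a₀ then θ * μ w.2 else 0) • R₁ w) = 0 := by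
        simp_rw [sub_smul, Finset.sum_sub_distrib]
        rw [sum_row_support a₀ (fun j => θ * μ j) R₁, ← hθ, sub_self]
      have hall := Fintype.linearIndependent_iff.1 hR₁ _ hcomb
      have hθ0 : θ = 0 := by
        have := hall (a₀, js)
        simp only [hg0, zero_sub, neg_eq_zero] at this
        rcases mul_eq_zero.1 this with h | h
        · exact h
        · exact absurd h hjs
      intro w
      have := hall w
      rw [hθ0] at this
      simpa using this
    -- every `ℓ'_{1,w}` with `w ≠ (a₀, js)` is nonzero
    have hR₁'ne : ∀ w, w ≠ (a₀, js) → R₁' w ≠ 0 := by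
      intro w hw h0
      have := hind (Pi.single w 1) (by rw [Pi.single_apply, if_neg (Ne.symm hw)]) (by
        simp_rw [Pi.single_apply, ite_smul, one_smul, zero_smul, Finset.sum_ite_eq',
          Finset.mem_univ, if_true, h0]) w
      simp at this
    -- the dual vector of `ℓ'_{1,(a₀,j₂)}` in the family `{ℓ'_{1,w}}_{w ≠ (a₀,js)}`
    have hjs₂ : ((a₀, js) : Fin s × Fin d) ≠ (a₀, j₂) := fun h => hj₂s (Prod.mk.inj h).2.symm
    obtain ⟨u, hu1, hu0⟩ : ∃ u : Fin n → K, R₁' (a₀, j₂) ⬝ᵥ u = 1 ∧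
        ∀ w, w ≠ (a₀, js) → w ≠ (a₀, j₂) → R₁' w ⬝ᵥ u = 0 := by
      obtain ⟨u, hu1, hu0⟩ := exists_dotProduct_eq_one_of_notMem_span
        (fun w : Fin s × Fin d => if w = (a₀, js) ∨ w = (a₀, j₂) then (0 : Fin n → K) else R₁' w)
        (R₁' (a₀, j₂)) (by
          intro hmem
          obtain ⟨cL, hcL⟩ := (Submodule.mem_span_range_iff_exists_fun K).1 hmem
          have hg := hind (fun w => (if w = (a₀, js) ∨ w = (a₀, j₂) then 0 else cL w) -
            if w = (a₀, j₂) then 1 else 0)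
            (by rw [if_pos (Or.inl rfl), if_neg hjs₂, sub_zero])
            (by
              simp_rw [sub_smul, Finset.sum_sub_distrib, ite_smul, one_smul, zero_smul,
                Finset.sum_ite_eq', Finset.mem_univ, if_true]
              rw [sub_eq_zero, ← hcL]
              refine Finset.sum_congr rfl fun w _ => ?_
              split_ifs with hw <;> simp)
            (a₀, j₂)
          simp at hg)
      refine ⟨u, hu1, fun w hw1 hw2 => ?_⟩
      have := hu0 w
      rwa [if_neg (not_or.2 ⟨hw1, hw2⟩)] at this
    have hu₂ : ∀ w : Fin s × Fin d, w.1 ≠ a₀ → R₂' w ⬝ᵥ u = 0 := by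
      rintro ⟨a, j⟩ ha
      obtain ⟨κ, hκ⟩ := hrow₂' a j
      rw [hκ, sum_dotProduct]
      refine Finset.sum_eq_zero fun j' _ => ?_
      rw [smul_dotProduct, hu0 (a, j') (fun h => ha (Prod.mk.inj h).1)
        (fun h => ha (Prod.mk.inj h).1), smul_zero]
    refine bind₁_ne_zero_of_forall_dirDeriv hG' _ u fun G'' hG'' => ?_
    -- the derivative of the first family
    have hD₁ : ∀ a : Fin s, (∑ k', C (u k') * pderiv k'
        (∏ j : Fin d, ∑ k'', C (R₁' (a, j) k'') * X k'' : MvPolynomial (Fin n) K)) =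
        if a = a₀ then
          (∏ j ∈ Finset.univ.erase j₂, ∑ k', C (R₁' (a₀, j) k') * X k' : MvPolynomial (Fin n) K) +
            C (R₁' (a₀, js) ⬝ᵥ u) * ∏ j ∈ Finset.univ.erase js, ∑ k', C (R₁' (a₀, j) k') * X k'
        else 0 := by
      intro a
      rw [dirDeriv_prod_linform]
      split_ifs with ha
      · subst ha
        rw [Finset.sum_eq_add_of_mem j₂ js (Finset.mem_univ _) (Finset.mem_univ _) hj₂s,
          hu1, C_1, one_mul]
        intro j _ hj
        rw [hu0 (a, j) (fun h => hj.2 (Prod.mk.inj h).2) (fun h => hj.1 (Prod.mk.inj h).2), C_0,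
          zero_mul]
      · exact Finset.sum_eq_zero fun j _ => by
          rw [hu0 (a, j) (fun h => ha (Prod.mk.inj h).1) (fun h => ha (Prod.mk.inj h).1), C_0,
            zero_mul]
    -- the derivative of the second family vanishes
    have hD₂ : ∀ a : Fin s, (∑ k', C (u k') * pderiv k'
        (∏ j : Fin d, ∑ k'', C (R₂' (a, j) k'') * X k'' : MvPolynomial (Fin n) K)) = 0 := by
      intro a
      rw [dirDeriv_prod_linform]
      refine Finset.sum_eq_zero fun j _ => ?_
      by_cases ha : a = a₀
      · subst ha
        by_cases hj : j = j₀
        · subst hj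
          rw [hlam, zero_dotProduct, C_0, zero_mul]
        · rw [Finset.prod_eq_zero (Finset.mem_erase.2 ⟨Ne.symm hj, Finset.mem_univ j₀⟩) (by
            rw [hlam]
            simp), mul_zero]
      · rw [hu₂ (a, j) ha, C_0, zero_mul]
    have hlin : ∀ (p q : MvPolynomial (Fin n) K),
        (∑ k', C (u k') * pderiv k' (p - q)) = (∑ k', C (u k') * pderiv k' p) -
          ∑ k', C (u k') * pderiv k' q := by
      intro p q
      simp only [map_sub, mul_sub, Finset.sum_sub_distrib]
    have hsum : ∀ (P : Fin s → MvPolynomial (Fin n) K),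
        (∑ k', C (u k') * pderiv k' (∑ a, P a)) = ∑ a, ∑ k', C (u k') * pderiv k' (P a) := by
      intro P
      simp_rw [map_sum, Finset.mul_sum]
      exact Finset.sum_comm
    rw [hlin, hsum, hsum]
    simp_rw [hD₁, hD₂, Finset.sum_ite_eq', Finset.mem_univ, if_true, Finset.sum_const_zero, sub_zero]
    -- factor: `∏_{j ≠ j₂} ℓ' + τ ∏_{j ≠ js} ℓ' = (ℓ'_{js} + τ ℓ'_{j₂}) · ∏_{j ∉ {j₂, js}} ℓ'`
    rw [← Finset.mul_prod_erase _ _ (Finset.mem_erase.2 ⟨Ne.symm hj₂s, Finset.mem_univ js⟩),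
      ← Finset.mul_prod_erase (Finset.univ.erase js) _ (Finset.mem_erase.2 ⟨hj₂s, Finset.mem_univ j₂⟩),
      Finset.erase_right_comm, ← mul_assoc, ← add_mul, map_mul, map_prod]
    refine mul_ne_zero ?_ (Finset.prod_ne_zero_iff.2 fun j hj => ?_)
    · -- the last linear form `ℓ'_{js} + τ ℓ'_{j₂}` is nonzero
      have hcombine : ((∑ k', C (R₁' (a₀, js) k') * X k' : MvPolynomial (Fin n) K) +
          C (R₁' (a₀, js) ⬝ᵥ u) * ∑ k', C (R₁' (a₀, j₂) k') * X k') =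
          ∑ k', C ((R₁' (a₀, js) + (R₁' (a₀, js) ⬝ᵥ u) • R₁' (a₀, j₂)) k') * X k' := by
        rw [Finset.mul_sum, ← Finset.sum_add_distrib]
        refine Finset.sum_congr rfl fun k' _ => ?_
        simp only [Pi.add_apply, Pi.smul_apply, smul_eq_mul, map_add, map_mul, add_mul, mul_assoc]
      rw [hcombine]
      refine bind₁_linform_ne_zero hG'' (by omega) fun hV => ?_
      -- `μ_js V = -(∑_{j ≠ js} μ_j ℓ'_j) + μ_js τ ℓ'_{j₂}`: a relation with coefficient `μ_{j₃} ≠ 0`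
      have hg := hind (fun w => if w.1 = a₀ then
          (if w.2 = js then 0 else μ w.2 - if w.2 = j₂ then μ js * (R₁' (a₀, js) ⬝ᵥ u) else 0)
          else 0)
        (by rw [if_pos rfl, if_pos rfl])
        (by
          rw [sum_row_support a₀ (fun j => if j = js then (0 : K) else
            μ j - if j = j₂ then μ js * (R₁' (a₀, js) ⬝ᵥ u) else 0) R₁']
          have e1 : ∀ j : Fin d, (if j = js then (0 : K) else
              μ j - if j = j₂ then μ js * (R₁' (a₀, js) ⬝ᵥ u) else 0) =
              μ j - (if j = js then μ js else 0) -
                (if j = j₂ then μ js * (R₁' (a₀, js) ⬝ᵥ u) else 0) := by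
            intro j
            by_cases h1 : j = js
            · subst h1
              rw [if_pos rfl, if_pos rfl, if_neg (Ne.symm hj₂s)]
              ring
            · rw [if_neg h1, if_neg h1]
              ring
          simp_rw [e1, sub_smul, Finset.sum_sub_distrib, ite_smul, zero_smul, Finset.sum_ite_eq',
            Finset.mem_univ, if_true, hrel, zero_sub]
          have hV' := congrArg (fun x => μ js • x) hV
          simp only [smul_add, smul_zero, smul_smul] at hV'
          rw [← neg_add', hV', neg_zero])
        (a₀, j₃)
      simp only [if_neg (Ne.symm hj3s), if_neg (Ne.symm hj₂₃), sub_zero] at hg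
      exact hj₃ hg
    · rw [Finset.mem_erase, Finset.mem_erase] at hj
      exact bind₁_linform_ne_zero hG'' (by omega) (hR₁'ne (a₀, j) fun h => hj.2.1 (Prod.mk.inj h).2)

end Endgame

/-! ### `d = 2`: quadratic forms (every field) -/

section DegreeTwo

variable {K : Type*} [Field K] {n c : ℕ}

/-- **Thm 45 for `d = 2`, every field**: a nonzero homogeneous QUADRATIC polynomial is hit by every
`2`-independent map — either some `∂f/∂x_i ≠ 0` is a nonzero linear form (Lemma 3.9 + Obs 3.3), or
all first partials vanish, every monomial of `f` is a square `x_i²`, and the Def-19 substitution of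
one block at a coordinate `i₀` with nonzero coefficient leaves `c · z² ≠ 0`. (Replaces, for `d = 2`,
the printed second-derivative step, which needs `2 ≠ 0`.)
[cite: MediniShpilka2021, proof of Thm 45 (arXiv p0036:L33-L50) and Def 19 (p0006:L64-L67), repaired] -/
theorem bind₁_ne_zero_of_isHomogeneous_two {k : ℕ}
    {G : Fin n → MvPolynomial (Fin (k + 2) × (Fin c ⊕ Unit)) K} (hG : IsIndependent (k + 2) G)
    {f : MvPolynomial (Fin n) K} (hf : f.IsHomogeneous 2) (hf0 : f ≠ 0) : bind₁ G f ≠ 0 := by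
  classical
  have hwd : ∀ m : Fin n →₀ ℕ, Finsupp.weight (1 : Fin n → ℕ) m = m.degree := fun m => by
    rw [Finsupp.degree_eq_weight_one]
    rfl
  by_cases hder : ∃ i, pderiv i f ≠ 0
  · obtain ⟨i, hi⟩ := hder
    have hhom : (pderiv i f).IsHomogeneous 1 := by
      intro m hm
      rw [coeff_pderiv] at hm
      have hc : coeff (m + Finsupp.single i 1) f ≠ 0 := left_ne_zero_of_mul hm
      have h2 := hf hc
      rw [hwd] at h2 ⊢
      rw [map_add, Finsupp.degree_single] at h2
      omega
    refine bind₁_ne_zero_of_forall_dirDeriv hG f (Pi.single i 1) fun G' hG' => ?_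
    have hdir : (∑ j, C ((Pi.single i 1 : Fin n → K) j) * pderiv j f) = pderiv i f := by
      rw [Finset.sum_eq_single i]
      · rw [Pi.single_eq_same, C_1, one_mul]
      · intro j _ hj
        rw [Pi.single_apply, if_neg hj, C_0, zero_mul]
      · intro h
        exact absurd (Finset.mem_univ i) h
    rw [hdir]
    exact bind₁_ne_zero_of_isHomogeneous_one hG' (by omega) hhom hi
  · push Not at hder
    -- every monomial of `f` is a square `x_i²`
    have hsq : ∀ m : Fin n →₀ ℕ, coeff m f ≠ 0 → ∃ i, m = Finsupp.single i 2 := by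
      intro m hm
      have hdeg : m.degree = 2 := by
        rw [← hwd]
        exact hf hm
      have hm0 : m ≠ 0 := by
        rintro rfl
        simp at hdeg
      obtain ⟨i, hi⟩ := Finsupp.ne_iff.1 hm0
      rw [Finsupp.zero_apply] at hi
      have hle : m i ≤ 2 := (Finsupp.le_degree i m).trans hdeg.le
      have hne1 : m i ≠ 1 := by
        intro h1
        have e := congr_arg (coeff (m - Finsupp.single i 1)) (hder i)
        rw [coeff_pderiv, coeff_zero,
          tsub_add_cancel_of_le (Finsupp.single_le_iff.2 (by omega : 1 ≤ m i)),
          Finsupp.tsub_apply, Finsupp.single_eq_same, h1] at e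
        norm_num at e
        exact hm e
      have hmi : m i = 2 := by omega
      refine ⟨i, ?_⟩
      have hle2 : Finsupp.single i 2 ≤ m := Finsupp.single_le_iff.2 hmi.ge
      have hsplit : m = Finsupp.single i 2 + (m - Finsupp.single i 2) :=
        (add_tsub_cancel_of_le hle2).symm
      have hrest : (m - Finsupp.single i 2).degree = 0 := by
        have e := congr_arg Finsupp.degree hsplit
        rw [map_add, Finsupp.degree_single, hdeg] at e
        omega
      rw [Finsupp.degree_eq_zero_iff] at hrest
      rw [hsplit, hrest, add_zero]
    obtain ⟨m₀, hm₀⟩ := ne_zero_iff.1 hf0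
    obtain ⟨i₀, rfl⟩ := hsq m₀ hm₀
    -- `f = ∑_i c_i x_i²`
    have hrep : f = ∑ i, C (coeff (Finsupp.single i 2) f) * X i ^ 2 := by
      ext m
      rw [coeff_sum]
      simp only [coeff_C_mul, coeff_X_pow, mul_ite, mul_one, mul_zero]
      by_cases hm : coeff m f = 0
      · rw [hm]
        refine (Finset.sum_eq_zero fun i _ => ?_).symm
        split_ifs with h
        · rw [h]
          exact hm
        · rfl
      · obtain ⟨i, rfl⟩ := hsq m hm
        rw [Finset.sum_eq_single i]
        · rw [if_pos rfl]
        · intro i' _ hi'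
          rw [if_neg]
          intro h
          exact hi' (Finsupp.single_left_injective (by norm_num) h)
        · intro h
          exact absurd (Finset.mem_univ i) h
    -- substitute one block at the coordinate `i₀`
    obtain ⟨φ, hφ⟩ := hG.exists_aeval_eq_single (by omega) i₀
    intro hzero
    have e := congr_arg (aeval φ) hzero
    rw [map_zero, aeval_bind₁] at e
    simp_rw [hφ] at e
    rw [hrep] at e
    simp only [map_sum, map_mul, algHom_C, algebraMap_eq, map_pow, aeval_X] at e
    rw [Finset.sum_eq_single i₀] at e
    · rw [if_pos rfl, C_mul_X_pow_eq_monomial, monomial_eq_zero] at e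
      exact hm₀ e
    · intro i _ hi
      rw [if_neg hi, zero_pow two_ne_zero, mul_zero]
    · intro h
      exact absurd (Finset.mem_univ i₀) h

end DegreeTwo

end MS2021

/-! ### The discharge of the fact -/

section Main

/-- **MS Thm 45, every field, as typed**: "Let `n, s₁, s₂, d₁, d₂ ∈ ℕ` be such that
`n ≥ s₁d₁, s₂d₂`. For `i ∈ {1,2}` let `f_i ∈ T_{s_i,d_i}^{GL_n(F)}`, and let `f = f₁ - f₂`. If `f ≠ 0`,
then any uniform `6`-independent `G` satisfies `f ∘ G ≠ 0`." Assembly: Step 1 (`d₁ ≠ d₂`), `d ≤ 1`,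
the span case (this seat's `MS21DiagonalTensorOrbitsHittingProofs.lean`), `d = 2`
(`bind₁_ne_zero_of_isHomogeneous_two`), and for `d ≥ 3` with equal spans the witness branch /
decoupling lemma / decoupled endgame (repaired argument; the printed sub-case "some `a_{i,j} ≥ 2`"
is not used). [cite: MediniShpilka2021, Thm 45 (CCC p.19:14; arXiv ‹PITsumSDMinv› p0009:L9-L12), proof §6.2 (p0036:L1-L52)] -/
theorem MS2021_thm_45_holds : MS2021_thm_45 := by
  intro K _ n s₁ s₂ d₁ d₂ c _ _ f₁ hf₁ f₂ hf₂ hne G hG hU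
  classical
  by_cases hd : d₁ = d₂
  swap
  · exact MS2021.bind₁_sub_ne_zero_of_degree_ne hd hf₁ hf₂ hne hG hU
  subst hd
  have hhom : (f₁ - f₂).IsHomogeneous d₁ :=
    (MS2021.isHomogeneous_of_mem_linOrbit_sdm hf₁).sub (MS2021.isHomogeneous_of_mem_linOrbit_sdm hf₂)
  rcases Nat.lt_or_ge d₁ 3 with hlt | hge
  · interval_cases d₁
    · -- `d = 0`: `f` is a nonzero constant
      have h0 : (f₁ - f₂).totalDegree = 0 := Nat.le_zero.1 hhom.totalDegree_le
      rw [totalDegree_eq_zero_iff_eq_C] at h0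
      rw [h0, bind₁_C_right]
      intro hC
      rw [C_eq_zero] at hC
      exact hne (by rw [h0, hC, C_0])
    · exact MS2021.bind₁_ne_zero_of_isHomogeneous_one hG (by norm_num) hhom hne
    · exact MS2021.bind₁_ne_zero_of_isHomogeneous_two hG hhom hne
  -- `d ≥ 3`
  have hd0 : 0 < d₁ := by omega
  obtain ⟨h₁, A₁, hA₁, rfl⟩ := MS2021.exists_affSubst_of_mem_linOrbit_sdm hf₁
  obtain ⟨h₂, A₂, hA₂, rfl⟩ := MS2021.exists_affSubst_of_mem_linOrbit_sdm hf₂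
  by_cases hspan₂ : ∀ v : Fin s₂ × Fin d₁, (fun k => A₂ (Fin.castLE h₂ (finProdFinEquiv v)) k) ∈
      Submodule.span K (Set.range fun w : Fin s₁ × Fin d₁ =>
        fun k => A₁ (Fin.castLE h₁ (finProdFinEquiv w)) k)
  swap
  · push Not at hspan₂
    obtain ⟨v₀, hv₀⟩ := hspan₂
    have := MS2021.bind₁_sub_ne_zero_of_notMem_span (by omega) h₂ h₁ A₁ hA₂ v₀ hv₀ hG
    rwa [← neg_sub, map_neg, neg_ne_zero] at this
  by_cases hspan₁ : ∀ w : Fin s₁ × Fin d₁, (fun k => A₁ (Fin.castLE h₁ (finProdFinEquiv w)) k) ∈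
      Submodule.span K (Set.range fun v : Fin s₂ × Fin d₁ =>
        fun k => A₂ (Fin.castLE h₂ (finProdFinEquiv v)) k)
  swap
  · push Not at hspan₁
    obtain ⟨w₀, hw₀⟩ := hspan₁
    exact MS2021.bind₁_sub_ne_zero_of_notMem_span (by omega) h₁ h₂ A₂ hA₁ w₀ hw₀ hG
  -- equal spans: `s₁ = s₂`
  have hli₁ : LinearIndependent K (fun w : Fin s₁ × Fin d₁ =>
      fun k => A₁ (Fin.castLE h₁ (finProdFinEquiv w)) k) :=
    (MS2021.linearIndependent_rows_castLE h₁ hA₁).comp _ finProdFinEquiv.injective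
  have hli₂ : LinearIndependent K (fun v : Fin s₂ × Fin d₁ =>
      fun k => A₂ (Fin.castLE h₂ (finProdFinEquiv v)) k) :=
    (MS2021.linearIndependent_rows_castLE h₂ hA₂).comp _ finProdFinEquiv.injective
  have hspanEq : Submodule.span K (Set.range fun w : Fin s₁ × Fin d₁ =>
      fun k => A₁ (Fin.castLE h₁ (finProdFinEquiv w)) k) =
      Submodule.span K (Set.range fun v : Fin s₂ × Fin d₁ =>
        fun k => A₂ (Fin.castLE h₂ (finProdFinEquiv v)) k) :=
    le_antisymm (Submodule.span_le.2 (Set.range_subset_iff.2 hspan₁))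
      (Submodule.span_le.2 (Set.range_subset_iff.2 hspan₂))
  have hcard := MS2021.card_eq_of_span_eq hli₁ hli₂ hspanEq
  simp only [Fintype.card_prod, Fintype.card_fin] at hcard
  have hs : s₁ = s₂ := Nat.eq_of_mul_eq_mul_right hd0 hcard
  subst hs
  -- the change-of-basis matrices `M` (ℓ₂ = M ℓ₁) and `N` (ℓ₁ = N ℓ₂), `M N = 1`
  obtain ⟨M, hM⟩ := MS2021.exists_matrix_of_forall_mem_span
    (fun w : Fin s₁ × Fin d₁ => fun k => A₁ (Fin.castLE h₁ (finProdFinEquiv w)) k)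
    (fun v : Fin s₁ × Fin d₁ => fun k => A₂ (Fin.castLE h₂ (finProdFinEquiv v)) k) hspan₂
  obtain ⟨N, hN⟩ := MS2021.exists_matrix_of_forall_mem_span
    (fun v : Fin s₁ × Fin d₁ => fun k => A₂ (Fin.castLE h₂ (finProdFinEquiv v)) k)
    (fun w : Fin s₁ × Fin d₁ => fun k => A₁ (Fin.castLE h₁ (finProdFinEquiv w)) k) hspan₁
  have hMN : ∀ c₁ c₂ : Fin s₁ × Fin d₁, (∑ w, M c₁ w * N w c₂) = if c₁ = c₂ then 1 else 0 := by
    intro c₁ c₂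
    have key : (∑ c' : Fin s₁ × Fin d₁, ((∑ w, M c₁ w * N w c') - if c₁ = c' then (1 : K) else 0) •
        (fun k => A₂ (Fin.castLE h₂ (finProdFinEquiv c')) k)) = 0 := by
      funext k
      simp only [Finset.sum_apply, Pi.smul_apply, smul_eq_mul, Pi.zero_apply, sub_mul,
        Finset.sum_sub_distrib, ite_mul, one_mul, zero_mul, Finset.sum_ite_eq, Finset.mem_univ,
        if_true]
      rw [sub_eq_zero, hM c₁ k]
      simp_rw [hN, Finset.mul_sum, Finset.sum_mul]
      rw [Finset.sum_comm]
      exact Finset.sum_congr rfl fun w _ => Finset.sum_congr rfl fun c' _ => by ring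
    have := Fintype.linearIndependent_iff.1 hli₂ _ key c₂
    exact sub_eq_zero.1 this
  -- witness or decoupling
  by_cases hW : ∃ c₁ c₂ : Fin s₁ × Fin d₁, (c₁ = c₂ ∨ c₁.1 ≠ c₂.1) ∧
      ∃ (a : Fin s₁) (j₁ j₂ : Fin d₁), j₁ ≠ j₂ ∧
        N (a, j₁) c₁ * N (a, j₂) c₂ + N (a, j₂) c₁ * N (a, j₁) c₂ ≠ 0
  · obtain ⟨c₁, c₂, hc, a, j₁, j₂, hj, hw⟩ := hW
    exact MS2021.bind₁_sub_ne_zero_of_witness hge h₁ h₂ hA₁ M N hM hMN c₁ c₂ hc a hj hw hG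
  push Not at hW
  have hS : ∀ (c' : Fin s₁ × Fin d₁) (a : Fin s₁) (j₁ j₂ : Fin d₁), j₁ ≠ j₂ →
      (2 : K) * N (a, j₁) c' * N (a, j₂) c' = 0 := by
    intro c' a j₁ j₂ hj
    have := hW c' c' (Or.inl rfl) a j₁ j₂ hj
    linear_combination this
  have hP : ∀ c₁ c₂ : Fin s₁ × Fin d₁, c₁.1 ≠ c₂.1 → ∀ (a : Fin s₁) (j₁ j₂ : Fin d₁), j₁ ≠ j₂ →
      N (a, j₁) c₁ * N (a, j₂) c₂ + N (a, j₂) c₁ * N (a, j₁) c₂ = 0 :=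
    fun c₁ c₂ hcc a j₁ j₂ hj => hW c₁ c₂ (Or.inr hcc) a j₁ j₂ hj
  obtain ⟨β, hβ, -, hβspan⟩ := MS2021.exists_bijective_span_eq_of_no_witness (by omega) _ _ hli₁ hli₂
    N hN hS hP
  -- explicit linear forms, second family reindexed by `β`
  rw [MS2021.affSubst_zero_rename_sum_prod_X h₁ A₁, MS2021.affSubst_zero_rename_sum_prod_X h₂ A₂]
    at hne ⊢
  have hre : (∑ b : Fin s₁, ∏ j : Fin d₁, ∑ k : Fin n,
      C (A₂ (Fin.castLE h₂ (finProdFinEquiv (b, j))) k) * X k : MvPolynomial (Fin n) K) =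
      ∑ a : Fin s₁, ∏ j : Fin d₁, ∑ k : Fin n,
        C (A₂ (Fin.castLE h₂ (finProdFinEquiv (β a, j))) k) * X k :=
    (Equiv.sum_comp (Equiv.ofBijective β hβ) fun b => (∏ j : Fin d₁, ∑ k : Fin n,
      C (A₂ (Fin.castLE h₂ (finProdFinEquiv (b, j))) k) * X k : MvPolynomial (Fin n) K)).symm
  rw [hre] at hne ⊢
  exact MS2021.bind₁_sub_ne_zero_of_decoupled hge
    (fun w : Fin s₁ × Fin d₁ => fun k => A₁ (Fin.castLE h₁ (finProdFinEquiv w)) k)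
    (fun w : Fin s₁ × Fin d₁ => fun k => A₂ (Fin.castLE h₂ (finProdFinEquiv (β w.1, w.2))) k)
    hli₁ (hli₂.comp (fun w : Fin s₁ × Fin d₁ => (β w.1, w.2)) fun w w' h => by
      have h' := Prod.mk.inj h
      exact Prod.ext (hβ.1 h'.1) h'.2)
    (fun a j => by
      rw [hβspan a]
      exact Submodule.subset_span ⟨j, rfl⟩) hne hG

end Main

end Literature.Computability.AlgebraicComplexity

end
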